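import Literature.AlgebraicGeometry.Resolution.QuadraticTransformsStructure
import Literature.AlgebraicGeometry.Resolution.QuadraticTransformsRegular
import HarnessLib

/-!
# Crux `TeissierReduction` (stmt-ResolutionOfSingularities-17085, route `TeissierJung`), line `Sketch`,
# stub `stub_zariskiFrameStep`: one quadratic transform transports a prime frame

Support lemma for the crux
`Summit.ResolutionOfSingularities.ResolutionOfSingularities.Theses.TeissierJung.TeissierReduction`
(stub `stub_zariskiFrameStep` of the line skeleton; idea card `valuative-koenig-surfaces`): the
r.s.p. BOOKKEEPING STEP of Zariski's monomialisation along a valuation (Zariski–Samuel II, App. 5;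
Abhyankar 1956).

Setting: `R ⊆ K` is a regular local ring whose maximal ideal is generated by two PRIME elements
`x, y` (a regular system of parameters if `dim R = 2`, two uniformisers if `R` is a discrete
valuation ring), `O` a valuation ring of `K` dominating `R`, and `R₁` the quadratic transform of `R`
along `O` (`IsQuadraticTransformAlong`, unique). Claim: `R₁` is regular, its maximal ideal is again
generated by two prime elements `x₁, y₁`, and `x`, `y` are units times monomials in `x₁, y₁`.

Proof. Say `ν(x) ≤ ν(y)` (the statement is symmetric), `t := y/x ∈ O`, `A := R[t] = R[𝔪/x]`; by
uniqueness of the transform along `O`, `R₁ = A_Q` with `Q = 𝔪_O ∩ A` the centre, so `𝔪₁ = Q R₁`;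
and `𝔭 := 𝔪_R A = xA ⊆ Q`.
* If `Q = 𝔭` (the divisorial case; this includes `dim R = 1`, where `t` is a unit of `R` and
  `A = R`): `𝔪₁ = (x)`, `x` is prime (`𝔪₁` is), `t ∉ Q` is a unit of `R₁`; frame `(x, x)`,
  `y = t · x`.
* If `Q ≠ 𝔭`: then `x ∤ y`, `𝔭` is the exceptional PRIME `xA` (`A/xA ≅ k[X]`), `0 ⊊ 𝔭 ⊊ Q` gives
  `dim R₁ ≥ 2`, and `Q = (x, g)` needs one more generator — `g = t` if `ν(t) > 0` (directly:
  `F(t) ≡ F(0) mod tA` and `F(0) ∈ 𝔪_R ⊆ xA`), else the lift `g = f` of a generator of `Q/xA`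
  (`exists_eq_span_pair_of_map_maximalIdeal_le`) with `t` a unit; so `𝔪₁ = (x, g)`, `dim R₁ = 2`
  (`R₁` is regular, `QuadraticTransformsRegular`), and both generators of `𝔪₁` are prime
  (`prime_of_maximalIdeal_eq_span_pair`: a member of a minimal generating pair lies in `𝔪 ∖ 𝔪²`).
  Frames `(x, t)` with `y = x · t`, resp. `(x, f)` with `y = t · x`.

* `prime_of_maximalIdeal_eq_span_pair` — generators of `𝔪 = (a, b)` of a two-dimensional regular
  local ring are prime (public);
* `zariskiFrameStep_of_valuation_le` — the claim under `ν(x) ≤ ν(y)`;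
* `stub_zariskiFrameStep` — the statement exactly as registered in the line skeleton.

[folklore]; no definitions, no named facts (all the quadratic-transform theory used is proved in
`Literature/AlgebraicGeometry/Resolution/QuadraticTransforms*.lean`).
-/

-- single-problem summit: the doubled namespace component is forced
set_option linter.dupNamespace false

noncomputable section

open IsLocalRing Polynomial Literature.AlgebraicGeometry.Resolution

namespace Summit.ResolutionOfSingularities.ResolutionOfSingularities.Theorems.TeissierReduction

/-! ## Generators of the maximal ideal of a two-dimensional regular local ring are prime -/

/-- In a two-dimensional regular local ring with `𝔪 = (a, b)`, the generator `a` is a prime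
element: `a ∉ 𝔪²` (else `𝔪 = (b) + 𝔪²`, so `𝔪 = (b)` by Nakayama, but `𝔪` is not principal),
and elements of `𝔪 ∖ 𝔪²` of a regular local ring are prime (Matsumura, Thm. 14.2–14.3).
[cite: Matsumura1987, Thm. 14.3] -/
theorem prime_of_maximalIdeal_eq_span_pair {S : Type*} [CommRing S] [IsRegularLocalRing S]
    (hdim : ringKrullDim S = 2) {a b : S} (h : maximalIdeal S = Ideal.span {a, b}) : Prime a := by
  -- adapted from Literature.AlgebraicGeometry.Resolution.QuadraticTransformsKeyLemma
  --   (`exists_maximalIdeal_eq_span_pair`, the `hy2` step)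
  have ha : a ∈ maximalIdeal S := h ▸ Ideal.subset_span (by simp)
  have hb : b ∈ maximalIdeal S := h ▸ Ideal.subset_span (by simp)
  refine IsRegularLocalRing.prime_of_not_mem_sq ha fun ha2 => ?_
  apply maximalIdeal_ne_span_singleton hdim b
  refine le_antisymm ?_ ((Ideal.span_singleton_le_iff_mem _).mpr hb)
  refine Submodule.le_of_le_smul_of_le_jacobson_bot (IsNoetherian.noetherian _)
    (maximalIdeal_le_jacobson _) ?_
  conv_lhs => rw [h]
  rw [Ideal.span_le]
  rintro _ (rfl | rfl)
  · refine Submodule.mem_sup_right ?_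
    rw [Ideal.smul_eq_mul, ← pow_two]
    exact ha2
  · exact Submodule.mem_sup_left (Ideal.mem_span_singleton_self _)

/-! ## The frame step -/

/-- **The frame step, for `ν(x) ≤ ν(y)`** (multiplicatively `O.valuation y ≤ O.valuation x`). Let
`R ⊆ K` be a regular local ring dominated by the valuation ring `O`, `𝔪_R = (x, y)` with `x, y`
prime, and `R₁` the quadratic transform of `R` along `O`. Then `R₁` is regular and
`𝔪_{R₁} = (x₁, y₁)` with `x₁, y₁` prime and `x`, `y` units times monomials in `x₁, y₁`. See the
module docstring for the proof (`t = y/x`, `R₁ = R[t]_{𝔪_O ∩ R[t]}`; frames `(x, x)`, `(x, t)` or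
`(x, f)`). [cite: ZariskiSamuel1960, Appendix 5] -/
theorem zariskiFrameStep_of_valuation_le {K : Type} [Field K] {O : ValuationSubring K}
    {R R₁ : Subring K} [IsRegularLocalRing R] (hdom : SubringDominates R O.toSubring)
    (hq : IsQuadraticTransformAlong O R R₁) {x y : R}
    (hm : maximalIdeal R = Ideal.span {x, y}) (hx : Prime x) (hy : Prime y)
    (hv : O.valuation (y : K) ≤ O.valuation (x : K)) :
    ∃ (h₁ : IsRegularLocalRing R₁) (x₁ y₁ : R₁),
      @IsLocalRing.maximalIdeal R₁ _ h₁.toIsLocalRing = Ideal.span {x₁, y₁} ∧ Prime x₁ ∧ Prime y₁ ∧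
      (∃ (a b : ℕ) (u : R₁), IsUnit u ∧ ((x : K)) = (u : K) * (x₁ : K) ^ a * (y₁ : K) ^ b) ∧
      (∃ (a b : ℕ) (u : R₁), IsUnit u ∧ ((y : K)) = (u : K) * (x₁ : K) ^ a * (y₁ : K) ^ b) := by
  classical
  have hRO : R ≤ O.toSubring := hdom.1
  have hx0 : x ≠ 0 := hx.ne_zero
  have hx0K : ((x : R) : K) ≠ 0 := fun e => hx0 (Subtype.ext e)
  have hxm : x ∈ maximalIdeal R := hm ▸ Ideal.subset_span (by simp)
  have hym : y ∈ maximalIdeal R := hm ▸ Ideal.subset_span (by simp)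
  have hval : ∀ a : R, a ∈ maximalIdeal R ↔ O.valuation (a : K) < 1 :=
    (subringDominates_valuationSubring_iff hRO).mp hdom
  -- the element `t = y/x ∈ O` and `y = t x`
  set t : K := ((y : R) : K) / ((x : R) : K) with ht
  have hvt1 : O.valuation t ≤ 1 := by
    rw [ht, map_div₀]
    exact div_le_one_of_le₀ hv zero_le
  have htO : t ∈ O := (O.valuation_le_one_iff _).mp hvt1
  have hyt : ((y : R) : K) = t * x := by rw [ht, div_mul_cancel₀ _ hx0K]
  -- the chart `A = R[t] = R[𝔪/x] ⊆ O`
  set A : Subring K := (Algebra.adjoin R {t}).toSubring with hAdef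
  have hA : blowupRing R (x : K) = A := blowupRing_eq_adjoin hm
  have hRA : R ≤ A := subring_le_adjoin R t
  have hAO : A ≤ O.toSubring := adjoin_toSubring_le hRO htO
  have htA : t ∈ A := Algebra.self_mem_adjoin_singleton R t
  -- `R₁ = A_{𝔪_O ∩ A}`: the `x`-chart computes the transform along `O` (uniqueness)
  have hR₁ : R₁ = locAtCentre A O := by
    have hspan : Ideal.span (↑({x, y} : Finset R) : Set R) = maximalIdeal R := by
      rw [Finset.coe_insert, Finset.coe_singleton, hm]
    have h' : IsQuadraticTransformAlong O R (locAtCentre (blowupRing R (x : K)) O) := by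
      refine ⟨inferInstance, hRO, {x, y}, x, hspan, Finset.mem_insert_self _ _, hx0, ?_, ?_⟩
      · intro z hz
        rcases Finset.mem_insert.mp hz with h | h
        · rw [h]
        · rw [Finset.mem_singleton] at h
          rw [h]
          exact hv
      · rw [blowupRing_eq_closure_of_span_eq (x : K) _ hspan]
    rw [hq.unique h', hA]
  haveI hreg : IsRegularLocalRing R₁ :=
    hq.isRegularLocalRing_of_isRegularLocalRing ‹IsRegularLocalRing R›
  subst hR₁
  set L : Subring K := locAtCentre A O with hLdef
  haveI : IsNoetherianRing A := isNoetherianRing_adjoin_toSubring R t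
  have hAL : A ≤ L := le_locAtCentre A O
  have htL : t ∈ L := hAL htA
  -- the centre `Q` of `O` on `A` and the exceptional ideal `𝔭 = 𝔪_R A = xA ⊆ Q`
  set Q : Ideal A := subringCentre A O hAO with hQdef
  haveI hQp : Q.IsPrime := subringCentre.isPrime A O hAO
  haveI : IsLocalization.AtPrime L Q := isLocalization_locAtCentre hAO
  set ιA : R →+* A := Subring.inclusion (subring_le_adjoin R t) with hιA
  set 𝔭 : Ideal A := (maximalIdeal R).map ιA with h𝔭def
  have h𝔭eq : 𝔭 = Ideal.span {ιA x} := by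
    rw [h𝔭def, hm]
    exact map_incl_span_pair hx0 y
  have h𝔭Q : 𝔭 ≤ Q := by
    rw [h𝔭def, Ideal.map_le_iff_le_comap]
    intro r hr
    rw [Ideal.mem_comap, hQdef, mem_subringCentre_iff]
    exact (hval r).mp hr
  have hιx0 : ιA x ≠ 0 := fun e => hx0K (congrArg (fun s : A => (s : K)) e)
  have hxQ : ιA x ∈ Q := h𝔭Q (h𝔭eq ▸ Ideal.mem_span_singleton_self _)
  -- the maximal ideal of `L` is the extension of `Q`
  have hmL : maximalIdeal L = Q.map (algebraMap A L) :=
    (IsLocalization.AtPrime.map_eq_maximalIdeal Q L).symm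
  have hmaxL : ∀ g : A, Q = Ideal.span {ιA x, g} →
      maximalIdeal L = Ideal.span {algebraMap A L (ιA x), algebraMap A L g} := by
    intro g hQg
    rw [hmL, hQg, Ideal.map_span, Set.image_insert_eq, Set.image_singleton]
  have e1 : ((algebraMap A L (ιA x) : L) : K) = x := rfl
  -- `t` as an element of `A`; `t ∉ 𝔭` as soon as `x ∤ y` (then `A/xA ≅ k[X]`, `t ↦ X`)
  set tA : A := ⟨t, htA⟩ with htAdef
  have ht𝔭 : (∀ s, x ∣ y * s → x ∣ s) → tA ∉ 𝔭 := by
    intro hpq hmem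
    obtain ⟨F, hF, hFt⟩ := exists_aeval_eq_of_mem_map_incl hmem
    have hzero : aeval t (F - X) = 0 := by
      rw [map_sub, aeval_X, hFt, sub_eq_zero]
    have h1 := coeff_mem_span_pair_of_aeval_eq_zero hx0 hpq hzero 1
    rw [coeff_sub, coeff_X_one, ← hm] at h1
    have h2 : (1 : R) ∈ maximalIdeal R := by
      simpa using (maximalIdeal R).sub_mem (hF 1) h1
    exact (maximalIdeal.isMaximal R).ne_top (Ideal.eq_top_of_isUnit_mem _ h2 isUnit_one)
  -- if `x ∣ y` then `t` is a unit of `R`, `A = R` and `Q = 𝔭`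
  have hdvd : x ∣ y → Q ≤ 𝔭 ∧ ¬ O.valuation t < 1 := by
    rintro ⟨c, hc⟩
    have hcu : IsUnit c := (hy.irreducible.isUnit_or_isUnit hc).resolve_left hx.not_unit
    have htc : t = (c : K) := by
      rw [ht, hc, Subring.coe_mul, mul_div_cancel_left₀ _ hx0K]
    have hcm : c ∉ maximalIdeal R := fun h =>
      mem_nonunits_iff.mp ((IsLocalRing.mem_maximalIdeal _).mp h) hcu
    refine ⟨fun a ha => ?_, fun hlt => hcm ((hval c).mpr (by rw [← htc]; exact hlt))⟩
    have hAR : A ≤ R := adjoin_toSubring_le le_rfl (by rw [htc]; exact c.2)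
    rw [hQdef, mem_subringCentre_iff] at ha
    have e : a = ιA ⟨a, hAR a.2⟩ := Subtype.ext rfl
    rw [e]
    exact Ideal.mem_map_of_mem _ ((hval ⟨a, hAR a.2⟩).mpr ha)
  by_cases hP : 𝔭 = Q
  · -- the divisorial case `Q = xA`: `𝔪_L = (x)`, `t` is a unit; frame `(x, x)`
    have hvt : ¬ O.valuation t < 1 := by
      intro hlt
      by_cases hxy : x ∣ y
      · exact (hdvd hxy).2 hlt
      · have htQ : tA ∈ Q := by
          rw [hQdef, mem_subringCentre_iff]
          exact hlt
        exact ht𝔭 (fun s h => (hx.dvd_or_dvd h).resolve_left hxy) (by rw [hP]; exact htQ)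
    have hmax : maximalIdeal L = Ideal.span {algebraMap A L (ιA x)} := by
      rw [hmL, ← hP, h𝔭eq, Ideal.map_span, Set.image_singleton]
    have hx₁0 : algebraMap A L (ιA x) ≠ 0 := fun e => hx0K (congrArg (fun s : L => (s : K)) e)
    have hx₁p : Prime (algebraMap A L (ιA x)) := by
      rw [← Ideal.span_singleton_prime hx₁0, ← hmax]
      exact (maximalIdeal.isMaximal L).isPrime
    have htu : IsUnit (⟨t, htL⟩ : L) := by
      by_contra h
      exact hvt ((not_isUnit_locAtCentre_iff hAO _).mp h)
    refine ⟨hreg, algebraMap A L (ιA x), algebraMap A L (ιA x), ?_, hx₁p, hx₁p,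
      ⟨1, 0, 1, isUnit_one, ?_⟩, ⟨1, 0, ⟨t, htL⟩, htu, ?_⟩⟩
    · rw [Set.pair_eq_singleton]
      exact hmax
    · rw [e1]
      simp
    · rw [e1, hyt]
      simp
  · -- `Q ≠ xA`: `x ∤ y`, `𝔭 = xA` is prime, and `L` is two-dimensional regular
    have hxy : ¬ x ∣ y := fun h => hP (le_antisymm h𝔭Q (hdvd h).1)
    have hpq : ∀ s, x ∣ y * s → x ∣ s := fun s h => (hx.dvd_or_dvd h).resolve_left hxy
    haveI h𝔭p : 𝔭.IsPrime := isPrime_map_incl (K := K) hx0 hpq hxm hym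
    -- adapted from Literature.AlgebraicGeometry.Resolution.QuadraticTransformsStructure
    --   (`IsQuadraticTransform.mem_or_inv_mem_or_isRegularLocalRing`, the height count)
    have twoDim : ∀ g : A, Q = Ideal.span {ιA x, g} →
        Prime (algebraMap A L (ιA x)) ∧ Prime (algebraMap A L g) := by
      intro g hQg
      have hmax := hmaxL g hQg
      have h𝔭lt : 𝔭 < Q := lt_of_le_of_ne h𝔭Q hP
      have hbot : (⊥ : Ideal A) < 𝔭 := by
        rw [bot_lt_iff_ne_bot, h𝔭eq, Ne, Ideal.span_singleton_eq_bot]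
        exact hιx0
      have hheight : (2 : ℕ∞) ≤ Q.height := by
        have h1 := Ideal.height_add_one_le_of_lt_of_isPrime hbot
        have h2 := Ideal.height_add_one_le_of_lt_of_isPrime h𝔭lt
        rw [Ideal.height_bot, zero_add] at h1
        calc (2 : ℕ∞) = 1 + 1 := by norm_num
          _ ≤ 𝔭.height + 1 := by gcongr
          _ ≤ Q.height := h2
      have hdimge : (2 : WithBot ℕ∞) ≤ ringKrullDim L := by
        rw [IsLocalization.AtPrime.ringKrullDim_eq_height Q L]
        exact WithBot.coe_le_coe.mpr hheight
      have hfr : (maximalIdeal L).spanFinrank ≤ 2 := by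
        rw [hmax]
        refine (Submodule.spanFinrank_span_le_ncard_of_finite (Set.toFinite _)).trans ?_
        exact (Set.ncard_insert_le _ _).trans (by rw [Set.ncard_singleton])
      have hdim : ringKrullDim L = 2 := by
        refine le_antisymm ?_ hdimge
        rw [← hreg.spanFinrank_maximalIdeal]
        exact_mod_cast hfr
      exact ⟨prime_of_maximalIdeal_eq_span_pair hdim hmax,
        prime_of_maximalIdeal_eq_span_pair hdim (hmax.trans (by rw [Set.pair_comm]))⟩
    by_cases hvt : O.valuation t < 1
    · -- `t ∈ 𝔪_L`: `Q = (x, t)`; frame `(x, t)`, `y = x t`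
      have htQ : tA ∈ Q := by
        rw [hQdef, mem_subringCentre_iff]
        exact hvt
      have hQ : Q = Ideal.span {ιA x, tA} := by
        refine le_antisymm (fun a ha => ?_) (span_pair_le_of_mem hxQ htQ)
        obtain ⟨F, hFa⟩ := exists_aeval_eq_of_mem_adjoin a.2
        -- `a = F(t) = F(0) + t · (F div X)(t)`
        set G : A := ⟨aeval t F.divX, Polynomial.aeval_mem_adjoin_singleton R t⟩ with hG
        have hF : aeval t F = t * aeval t F.divX + ((F.coeff 0 : R) : K) := by
          conv_lhs => rw [← X_mul_divX_add F]
          rw [map_add, map_mul, aeval_X, aeval_C, Algebra.algebraMap_ofSubsemiring_apply]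
        have hdec : a = ιA (F.coeff 0) + tA * G := by
          apply Subtype.ext
          change (a : K) = ((F.coeff 0 : R) : K) + t * aeval t F.divX
          rw [← hFa, hF, add_comm]
        -- the constant term lies in `Q ∩ R = 𝔪_R`, hence in `𝔭 = xA`
        have hc : ιA (F.coeff 0) ∈ Q := by
          have := Q.sub_mem ha (Q.mul_mem_right G htQ)
          rwa [hdec, add_sub_cancel_right] at this
        have hcm : F.coeff 0 ∈ maximalIdeal R := by
          rw [hQdef, mem_subringCentre_iff] at hc
          exact (hval _).mpr hc
        have hc𝔭 : ιA (F.coeff 0) ∈ Ideal.span {ιA x, tA} := by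
          have hmem : ιA (F.coeff 0) ∈ 𝔭 := Ideal.mem_map_of_mem _ hcm
          rw [h𝔭eq] at hmem
          exact Ideal.span_mono (Set.singleton_subset_iff.mpr (Set.mem_insert _ _)) hmem
        rw [hdec]
        exact Ideal.add_mem _ hc𝔭 (Ideal.mul_mem_right _ _ (Ideal.subset_span (by simp)))
      obtain ⟨hpx, hpt⟩ := twoDim tA hQ
      have e2 : ((algebraMap A L tA : L) : K) = t := rfl
      refine ⟨hreg, algebraMap A L (ιA x), algebraMap A L tA, hmaxL tA hQ, hpx, hpt,
        ⟨1, 0, 1, isUnit_one, ?_⟩, ⟨1, 1, 1, isUnit_one, ?_⟩⟩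
      · rw [e1]
        simp
      · rw [e1, e2, hyt, OneMemClass.coe_one]
        ring
    · -- `t` is a unit of `L` and `Q = (x, f)`; frame `(x, f)`, `y = t x`
      obtain ⟨f, hQf⟩ := exists_eq_span_pair_of_map_maximalIdeal_le hm hx0 rfl h𝔭Q
      obtain ⟨hpx, hpf⟩ := twoDim f hQf
      have htu : IsUnit (⟨t, htL⟩ : L) := by
        by_contra h
        exact hvt ((not_isUnit_locAtCentre_iff hAO _).mp h)
      refine ⟨hreg, algebraMap A L (ιA x), algebraMap A L f, hmaxL f hQf, hpx, hpf,
        ⟨1, 0, 1, isUnit_one, ?_⟩, ⟨1, 0, ⟨t, htL⟩, htu, ?_⟩⟩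
      · rw [e1]
        simp
      · rw [e1, hyt]
        simp

set_option linter.unusedVariables false in
/-- **STUB `stub_zariskiFrameStep`** (card `valuative-koenig-surfaces`; the r.s.p. bookkeeping of
Zariski's monomialisation, ONE quadratic transform). Let `R` be a regular local ring of `K` whose
maximal ideal is generated by two PRIME elements `x, y` (a regular system of parameters if
`dim R = 2`, two uniformisers if `R` is a discrete valuation ring), dominated by the valuation ring
`O`, and `R₁` its quadratic transform along `O`. Then `R₁` is regular, its maximal ideal is again
generated by two prime elements `x₁, y₁`, and `x`, `y` are units times monomials in `x₁, y₁`.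
By symmetry one may assume `ν(x) ≤ ν(y)` (`zariskiFrameStep_of_valuation_le`). The hypothesis
`IsLocalRingOf R` of the registered signature is not needed (hence the linter option).
[cite: ZariskiSamuel1960, Appendix 5] -/
theorem stub_zariskiFrameStep {K : Type} [Field K] (O : ValuationSubring K) (R R₁ : Subring K)
    [IsRegularLocalRing R] (hof : IsLocalRingOf R) (hdom : SubringDominates R O.toSubring)
    (hq : IsQuadraticTransformAlong O R R₁) (x y : R)
    (hm : IsLocalRing.maximalIdeal R = Ideal.span {x, y}) (hx : Prime x) (hy : Prime y) :
    ∃ (h₁ : IsRegularLocalRing R₁) (x₁ y₁ : R₁),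
      @IsLocalRing.maximalIdeal R₁ _ h₁.toIsLocalRing = Ideal.span {x₁, y₁} ∧ Prime x₁ ∧ Prime y₁ ∧
      (∃ (a b : ℕ) (u : R₁), IsUnit u ∧ ((x : K)) = (u : K) * (x₁ : K) ^ a * (y₁ : K) ^ b) ∧
      (∃ (a b : ℕ) (u : R₁), IsUnit u ∧ ((y : K)) = (u : K) * (x₁ : K) ^ a * (y₁ : K) ^ b) := by
  rcases le_total (O.valuation (y : K)) (O.valuation (x : K)) with h | h
  · exact zariskiFrameStep_of_valuation_le hdom hq hm hx hy h
  · obtain ⟨h₁, x₁, y₁, hmax, hp, hp', hY, hX⟩ :=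
      zariskiFrameStep_of_valuation_le hdom hq (hm.trans (by rw [Set.pair_comm])) hy hx h
    exact ⟨h₁, x₁, y₁, hmax, hp, hp', hX, hY⟩

end Summit.ResolutionOfSingularities.ResolutionOfSingularities.Theorems.TeissierReduction

end
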